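import Summits.PneNP.PneNP.Theorems.RootDecompSegregatorSmallSegregators.Negative.KSS6
import Summits.PneNP.PneNP.Theses.RootDecompSegregator

/-!
# `RootDecompSegregator.SegregatorLift` (stmt-PneNP-26298) — the dead sub-line's lift, vacuously

Node N7 of the decomp-pnenp root-decomposition cell (route `route-PneNP-RootDecompSegregator`) split its
shadow `EqExpRungLog` («DTIME(n log n) ≠ NTIME(n log n)», stmt-PneNP-26196) along Santhanam's segregator
hypothesis into `SmallSegregators` (stmt-PneNP-26297) and `SegregatorLift := SmallSegregators →
EqExpRungLog` (stmt-PneNP-26298).  `SmallSegregators` is REFUTED in the tree (K\*\*: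
`Summit.PneNP.PneNP.Theorems.RootDecompSegregatorSmallSegregators_refuted`, lens-1 g5, ancestor-robust
de Bruijn butterflies at `r = 3`, `k = 172`), so the lift holds vacuously — the rev-3 record of the route
file («support → VACUOUS-TRUE once ¬SmallSegregators lands»).  This file closes the dead sub-line's open
support item so the route's item list carries no live debt on it (census tribunal batch 1,
TRIB-PNENP-ROOTDECOMP-1: «dead sub-line items 26298/26299 still open»).  0 sorry.
-/

namespace Summit.PneNP.PneNP.Theorems

/-- `SegregatorLift` (stmt-PneNP-26298) holds vacuously: its hypothesis `SmallSegregators` is refuted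
in the tree — the same one-line kill switch as `RootDecompSegregatorSmallSegregators_refuted`
(`not_smallSegregatorsAt_of_ancestorRobust ancestorRobust_three` at `r = 3`, imported from the
route-independent `Negative.KSS6` chain).  (decomp-pnenp cell, 2026-08-30.) -/
theorem segregatorLift_proof :
    Summit.PneNP.PneNP.Theses.RootDecompSegregator.SegregatorLift := by
  unfold Summit.PneNP.PneNP.Theses.RootDecompSegregator.SegregatorLift
  intro hS
  exact (RootDecompSegregatorSmallSegregators.Negative.not_smallSegregatorsAt_of_ancestorRobust
    RootDecompSegregatorSmallSegregators.Negative.ancestorRobust_three (hS 3)).elim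

end Summit.PneNP.PneNP.Theorems
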